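import Literature.NumberTheory.DiophantineApproximation.PolylogShiftHermitePadeBricks
import Literature.NumberTheory.DiophantineApproximation.DilogHermitePadeArithmetic
import HarnessLib

/-!
# Type-I Hermite–Padé forms for the shifted polylogarithms (`m` shifts, `s ≤ w`) — the partial fraction expansion

Topic `Literature/NumberTheory/DiophantineApproximation`. For the `m`-shift kernel
`K^{(m,w)}_n(u) = m^{2wn} (u − wn + 1)_{wn} / (mu+1)_{n+1}^w` (`ShiftPade.kernelM`, vocabulary in
`PolylogShiftHermitePade.lean`; the `m`-shift generalisation of the parity programme
`PolylogTwoPointHermitePade*.lean` after David–Hirata-Kohno–Kawashima 2020, Thm 2.1) we prove, in the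
variable `t = mu`,

* `kernelM_eq_prod_brickEval`: `K^{(m,w)}_n(u) = ∏_{s<w} B_s(mu)` is the product of the `w` bricks
  `B_s(t) = m^{2n} (t/m − (s+1)n + 1)_n/(t+1)_{n+1} = ∑_μ (resM m n s μ)/(t+μ+1)`
  (`ShiftPade.brickM_eq_brickEval`; the numerator identity is `BallRivoal.poch_mul` reindexed by
  `L ↦ w − 1 − s`, together with `m^{2wn} = ∏_{s<w} m^{2n}`);
* `exists_pf_kernelM`: hence (`BallRivoal.exists_pf_prod` with `d = d_n = lcm(1, …, n)`) there are
  rationals `c_{o,p}` (`o < w`, `p ≤ n`) with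
  `K^{(m,w)}_n(u) = ∑_{p ≤ n} ∑_{o<w} c_{o,p}/(mu+p+1)^{o+1}` away from the poles,
  `d_n^{w−1−o} c_{o,p} ∈ ℤ` and `∑ |c_{o,p}| ≤ w! ∏_{s<w} m^{2n} 2^{(ms+3)n+1}`.

This is the `m`-shift counterpart of `PolylogTwoPointHermitePadeExpansion.lean`
(`ParityPade.kernelH_eq_prod_brickEval`, `ParityPade.exists_pf_kernelH`, `m = 2`). Everything is PROVED; no
definitions, no named facts.

References: S. David, N. Hirata-Kohno, M. Kawashima, *Can polylogarithms at algebraic points be linearly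
independent?*, Moscow J. Comb. Number Th. 9 (2020) 389–406, Thm 2.1 [DavidHirataKohnoKawashima2020];
T. Rivoal, C. R. Acad. Sci. Paris 331 (2000), §2 proof of Lemme 5 (the bricks and their partial
fractions) [Rivoal2000].
-/

open Finset

namespace Literature.NumberTheory.DiophantineApproximation

namespace ShiftPade

open Literature.NumberTheory.Transcendental

/-- **The `m`-shift kernel is the product of its bricks**: for `mu ∉ {−1, …, −(n+1)}`,
`K^{(m,w)}_n(u) = ∏_{s<w} B_s(mu)` with
`B_s(t) = ∑_μ (resM m n s μ)/(t+μ+1) = m^{2n} (t/m − (s+1)n + 1)_n/(t+1)_{n+1}` (`brickM_eq_brickEval`), since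
`(u − wn + 1)_{wn} = ∏_{s<w} (u − (s+1)n + 1)_n` (`BallRivoal.poch_mul`, reindexed by `s ↦ w − 1 − s`) and
`m^{2wn} = ∏_{s<w} m^{2n}`. [cite: DavidHirataKohnoKawashima2020, Thm 2.1] -/
theorem kernelM_eq_prod_brickEval (m w n : ℕ) (hm : 1 ≤ m) (u : ℚ)
    (hu : ∀ μ, μ ≤ n → m * u + μ + 1 ≠ 0) :
    kernelM m w n u = ∏ s ∈ Finset.range w, BallRivoal.brickEval n (resM m n s) (m * u) := by
  have hm' : (m : ℚ) ≠ 0 := by exact_mod_cast (by omega : m ≠ 0)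
  have hpoch : BallRivoal.poch (m * u + 1) (n + 1) ≠ 0 := by
    rw [BallRivoal.poch]
    exact prod_ne_zero_iff.2 fun μ hμ => by
      have := hu μ (Nat.lt_succ_iff.1 (mem_range.1 hμ))
      intro h
      apply this
      linarith
  have hDr : BallRivoal.poch (m * u + 1) (n + 1) ^ w =
      ∏ _L ∈ range w, BallRivoal.poch (m * u + 1) (n + 1) := by
    rw [prod_const, card_range]
  have hpow : (m : ℚ) ^ (2 * (w * n)) = ∏ _L ∈ range w, (m : ℚ) ^ (2 * n) := by
    rw [prod_const, card_range, ← pow_mul, mul_assoc, mul_comm n w]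
  have hF : ∏ L ∈ range w, BallRivoal.brickEval n (resM m n L) (m * u) =
      (m : ℚ) ^ (2 * (w * n)) * BallRivoal.poch (u - w * n + 1) (w * n) /
        BallRivoal.poch (m * u + 1) (n + 1) ^ w := by
    rw [eq_div_iff (pow_ne_zero _ hpoch), BallRivoal.poch_mul, hpow, hDr, ← prod_mul_distrib,
      ← prod_mul_distrib]
    conv_rhs => rw [← prod_range_reflect]
    refine prod_congr rfl fun L hL => ?_
    have hL' : L < w := mem_range.1 hL
    rw [← brickM_eq_brickEval m n L hm (m * u) hu, div_mul_cancel₀ _ hpoch, mul_div_cancel_left₀ u hm']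
    congr 2
    rw [Nat.cast_sub (by omega : L ≤ w - 1), Nat.cast_sub (by omega : 1 ≤ w)]
    push_cast
    ring
  rw [hF, kernelM]

/-- **Partial fractions of the `m`-shift kernel**: for `1 ≤ w` there are rationals `c_{o,p}`
(`o < w`, `p ≤ n`) with `K^{(m,w)}_n(u) = ∑_{p ≤ n} ∑_{o<w} c_{o,p}/(mu+p+1)^{o+1}` for
`mu ∉ {−1, …, −(n+1)}`, `d_n^{w−1−o} c_{o,p} ∈ ℤ` (`d_n = lcm(1, …, n)`), and
`∑ |c_{o,p}| ≤ w! ∏_{s<w} m^{2n} 2^{(ms+3)n+1}` — `BallRivoal.exists_pf_prod` applied to the bricks of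
`kernelM_eq_prod_brickEval`, with `∑_μ |resM m n s μ| ≤ m^{2n} 2^{(ms+3)n+1}` (`sum_abs_resM_le`).
[cite: DavidHirataKohnoKawashima2020, Thm 2.1] -/
theorem exists_pf_kernelM (m w n : ℕ) (hm : 1 ≤ m) (hw : 1 ≤ w) :
    ∃ c : ℕ → ℕ → ℚ,
      (∀ u : ℚ, (∀ μ, μ ≤ n → m * u + μ + 1 ≠ 0) →
        BallRivoal.pfEval n w c (m * u) = kernelM m w n u) ∧
      BallRivoal.IsInt w (Nat.lcmUpto n) c ∧
      BallRivoal.l1 n w c ≤ (w.factorial : ℚ) *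
        ∏ s ∈ Finset.range w, ((m : ℚ) ^ (2 * n) * 2 ^ ((m * s + 3) * n + 1)) := by
  have hdiv : ∀ k : ℕ, 1 ≤ k → k ≤ n → (k : ℤ) ∣ (Nat.lcmUpto n : ℤ) :=
    fun k h1 h2 => DilogPade.natCast_dvd_lcmUpto h1 h2
  obtain ⟨c, hc, hint, hl1⟩ :=
    BallRivoal.exists_pf_prod n (Nat.lcmUpto n) hdiv (resM m n) w hw
  refine ⟨c, fun u hu => ?_, hint, hl1.trans ?_⟩
  · rw [hc (m * u) hu, kernelM_eq_prod_brickEval m w n hm u hu]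
  · refine mul_le_mul_of_nonneg_left ?_ (by positivity)
    refine prod_le_prod (fun s _ => sum_nonneg fun _ _ => abs_nonneg _) fun s _ => ?_
    exact sum_abs_resM_le m n s hm

end ShiftPade

end Literature.NumberTheory.DiophantineApproximation
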